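import Summits.HodgeConjecture.HodgeConjecture.Theorems.HCCMUnconditionalH21OfAbelianSchemeModel
import Summits.HodgeConjecture.HodgeConjecture.Theorems.HCCMUnconditionalShimuraThm18_6Holds
import HarnessLib

/-!
# `HCCMUnconditional.H21` — CLOSING FILE of item stmt-HodgeConjecture-24834 (binder `h21`, [Shimura 1998, Thm. 21.4 (Casselman)] AS PRINTED)

Topic: summit `HodgeConjecture`, sub-problem `HodgeConjecture`, route `HCCMUnconditional` (Theses file of record), crux `H21`
(= the pack decl `PrintedCitationHypotheses.Hyp21 := Literature.NumberTheory.ComplexMultiplication.shimura1998_thm21_4_casselman`, by `rfl`: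
[Shimura 1998] Thm. 21.4 «there exists a structure (A, 𝒞, ι) of type (K, Φ, 𝔞, ζ) rational over k which determines χ», with «determines χ»
read through Prop. 19.10 and the Frobenius sentence of Thm. 19.11's proof — editions E-19.11♭1 (Thm. 19.11's iff NOT recorded) and E-ST
(the Frobenius clause keyed on Serre–Tate good reduction «an abelian-scheme model over 𝓞_{k,v}», [SerreTate1968] §1 p. 492) of the cell
`hodgecm-mathlib`, both WEAKENINGS toward print, REF1/ref2-audited).  PROVER FILE (cell `hodgecm-mathlib`, D-0151 release track, ladder
HODGECM-MATHLIB rung 0; seat B-p14; `--workitem stmt-HodgeConjecture-24834`; D-0016): theorems only, sorry-free, axioms ⊆ the trio.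

CHAIN OF RECORD (every link a tree theorem, consumed BY NAME — ZERO hypotheses):
* `Theorems.shimura1998_thm18_6_holds : shimura1998_thm18_6` — [Shimura 1998] Thm. 18.6, THE MAIN THEOREM OF COMPLEX MULTIPLICATION, a
  theorem of the tree (B-p15 ★ p631138 over the fan-B line `b2_main_theorem_cm`: B-typ03's junction `shimura1998_thm18_6_of_levelStructure`,
  S7a `levelStructure` (B-p15/B-p11/B-p12 …), S7b `levelGluing_holds` (B-p12), S7c `modelReduction_holds` (B-p06), S5b (A-p02/B-p06/B-typ02),
  S2₁′ `shimuraTaniyamaPair_degOne'_holds` (A-p02's E2 line), Q5 `…_tateSpecialisation_holds` (B-p20/B-p09/B-p07/A-p14/A-p04), II-2 (A-p14));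
* `CorCM.Hyp21.casselmanST_of_thm18_6 (h186)` (A-p08, `HCCMUnconditionalH21OfAbelianSchemeModel` ★ p629418; its conclusion IS the body of
  the binder `shimura1998_thm21_4_casselman` since edition E-ST ★ p631097, so it inhabits `HCCMUnconditional.H21` by unfolding — the
  «S10-free form» of director g4 RULINGS s42/s44, REF1 device ★ PASS by import 12:16:27Z `referees/repro/H21-closer-s42form.ref1.lean`): the
  Casselman core `casselmanCore_of_thm18_6` (A-p01's line a2 / a2b: A-p02, A-p01, A-p03, A-p11, A-p14, A-p08, A-p04; II-2 discharged A-p14/B-p16)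
  + the Serre–Tate-keyed Shimura–Taniyama family `shimuraTaniyama_heckeCharactersST_of_thm18_6` (A-p08 ★ p628695, after A-p04 / B-p21's II-5♭;
  Thm. 19.8 / Prop. 19.10 / Thm. 19.11 ⇐ with Lemma 19.5 over the PROVED Serre–Tate §1 chain of B-p07/B-p09) — no inertia hypothesis, no
  converse of Néron–Ogg–Šafarevič, no bridge r₀.

§1 `H21_proof : HCCMUnconditional.H21` — the GATE-SHAPE HEAD closing the item; §2 the same statement under the pack name
`PrintedCitationHypotheses.Hyp21` and under the Literature name `shimura1998_thm21_4_casselman` (both `rfl`-equal to the route decl).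

HC_CM is proved only modulo the 7 printed citations until rung 0 closes; this file discharges `h21` outright (the second of the seven binders to
become a hypothesis-free tree theorem, after `hD3` ★ p613567; books of record: INVENTORY §8).

## References
* [Shimura1998] G. Shimura, *Abelian Varieties with Complex Multiplication and Modular Functions*, Princeton Univ. Press (1998):
  §21.4 Thm. 21.4 and its proof (p. 192); Prop. 19.10, (19.10g); Thm. 19.11 (proof) with Lemma 19.5; §18.6 Thm. 18.6.
* [SerreTate1968] J.-P. Serre, J. Tate, *Good reduction of abelian varieties*, Ann. of Math. 88 (1968), §1 (definition, p. 492), Thm. 1,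
  Lemma 2; §7 Thm. 10–12.
-/

set_option autoImplicit false

-- `Summit.HodgeConjecture.HodgeConjecture.Theorems` is the mandated namespace (single-problem summit: Problem = Summit), which
-- `linter.dupNamespace` flags; the lakefile turns the linter off tree-wide (weak option), restated here so stand-alone elaboration is
-- warning-free too.
set_option linter.dupNamespace false

namespace Summit.HodgeConjecture.HodgeConjecture.Theorems

open Literature.NumberTheory.ComplexMultiplication

/-! ## §1. The gate-shape head -/

/-- **`HCCMUnconditional.H21` — [Shimura 1998, Thm. 21.4] (Casselman) in the binder's form, PROVED with ZERO hypotheses: CLOSING HEAD of item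
stmt-HodgeConjecture-24834.**  A-p08's producer `CorCM.Hyp21.casselmanST_of_thm18_6` (the `h21` leg from row II-1 alone, editions E-19.11♭1 + E-ST; its
conclusion is the binder's body verbatim) fed with the tree theorem `shimura1998_thm18_6_holds` ([Shimura 1998] Thm. 18.6).  HC_CM is proved only modulo the 7 printed citations until rung 0 closes.
[cite: Shimura1998, §21.4 Thm. 21.4 (proof, p. 192); Prop. 19.10; §18.6 Thm. 18.6] [cite: SerreTate1968, §1 Thm. 1; §7 Thm. 10–12] -/
theorem H21_proof : Summit.HodgeConjecture.HodgeConjecture.Theses.HCCMUnconditional.H21 :=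
  Summit.HodgeConjecture.CorCM.Hyp21.casselmanST_of_thm18_6 shimura1998_thm18_6_holds

/-! ## §2. The same statement under its other two names -/

/-- **The pack hypothesis `PrintedCitationHypotheses.Hyp21` (= the item's signature) HOLDS** (`Hyp21 = HCCMUnconditional.H21` by `rfl`).
[cite: Shimura1998, §21.4 Thm. 21.4] -/
theorem hyp21_proof :
    Summit.HodgeConjecture.CorCM.D2Bridge.MuKeyIdentLemD3DelRecConjOmegaEndT.PrintedCitationHypotheses.Hyp21 :=
  H21_proof

/-- **[Shimura 1998, Thm. 21.4] (Casselman) — the Literature binder `shimura1998_thm21_4_casselman` HOLDS** (editions E-19.11♭1 + E-ST reading;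
`= HCCMUnconditional.H21` by `rfl`). [cite: Shimura1998, §21.4 Thm. 21.4; §18.6 Thm. 18.6] -/
theorem shimura1998_thm21_4_casselman_holds : shimura1998_thm21_4_casselman :=
  H21_proof

end Summit.HodgeConjecture.HodgeConjecture.Theorems
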